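/-
Copyright (c) 2026 the pub-hodgecm-mathlib formalisation cell (harness21).  Prover seat hodgecm-mathlib-F0P2-p10 (g2), Track B «K2-LIT»,
#184♮ = hLiu418 = `stmt-HodgeConjecture-24832`; socket #41, KIND 1, organ (K1b-W), seam (KW1-e) PART 3a = (e3-loc): THE LOCAL CORNER CHART AND THE LOCAL SPHERICAL PULL-BACK
`Λ_{s,v}(B_v(u)·k) = Λ⁽ᴮ⁾_{s+n₁∕2,v}(u)`.  THEOREMS ONLY (no `def`, no `instance`, no notation, no named-fact hypothesis, no `sorry`).
-/
import Summits.HodgeConjecture.HodgeConjecture.Theorems.K2LiuBlockDiagIntegral            -- ★ (e2′) p862755 (+ ★ (e2) `K2LiuBlockDiagPlaces`)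
import Summits.HodgeConjecture.HodgeConjecture.Theorems.K2LiuBlockDiagSectionPullback      -- ★ (T4-α) pt 1 p862495: `siegelDeltaCharacter_blkD_inr`
import Summits.HodgeConjecture.HodgeConjecture.Theorems.K2LiuDoublingHeckeIteration        -- ★ `eq_of_archPart_eq_of_forall_evalPlace_eq`, `evalPlace_finPart_inclPlaceAdelic` (two places)
import Literature.NumberTheory.K2Lit.LocalDoublingSiegel                                  -- ★ `siegelDeltaLoc`, `siegelCharLoc`, `LambdaLoc`, `lambdaLoc_mul_eq`, `IsSiegelIntDecomp`
import HarnessLib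

/-!
# Crux `HLiu418`, socket #41, KIND 1 ∕ (K1b-W), seam (KW1-e) PART 3a — `K2LiuKindOneLineLocalPullback`: THE LOCAL CORNER CHART `B_v(u) := (blkD (1, ι_v u))_v` AND
# THE LOCAL SPHERICAL PULL-BACK `Λ^{(V)}_{s,v}(B_v(u) · k) = Λ^{(V₂)}_{s + n₁∕2, v}(u)`

Cell `hodgecm-mathlib`, crux item hLiu418 = `stmt-HodgeConjecture-24832` (route of record `HCCMUnconditional`); squad K2 ∕ K2Liu, road `K2_Liu`, socket #41, KIND 1,
K1-b♮ line term; (K1b-W) line lead K2Liu-p14 (g4) (LINE WORD #1 2026-09-04T22:42:47Z (1): «`T`-components `y ↦ f_{s,v}(blkD_v(1,y)·g_v)` (p10's (e3)), spherical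
`Λ⁽¹⁾_{s+½,v}` off `T(g)`»), K1 desk F0P2-p11 (g2) (memo addendum 22:51:03Z: «THE ONE SEAM LEFT FOR K1-b♮ = `IsFactorizableOff` of the pulled-back family — needs a compatibility
`blkD ∘ locToAdelic⁽ᴮ⁾_v = locToAdelic⁽ⱽ⁾_v ∘ blkLoc_v`»).  THEOREMS ONLY; lane `--supports stmt-HodgeConjecture-24832 --as helper` (count-neutral).

THE DEVICE (no definition).  The local corner chart is NAMED through the tree's adelic objects: `B_v(u) := (blkD (1, ι_v u))_v ∈ U(J^𝔻_V)(L⁺_v)` with `ι_v = ★ locToAdelic v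
= UnitaryGroup.inclPlaceAdelic v`; by ★ (e2) its GL-matrix is `σ⁻¹[diag(1, u_w)]_w`.  Since the tree's LOCAL Siegel vocabulary is defined THROUGH `ι_v` (★ `siegelDeltaLoc v =
siegelDelta.comap ι_v`, ★ `siegelCharLoc v χ s u = siegelDeltaCharacter χ s (ι_v u)`), everything reduces to the adelic ★ lemmas of `blkD` once
**`ι_v (B_v u) = blkD (1, ι_v u)`** (§1, component extensionality ★ `eq_of_archPart_eq_of_forall_evalPlace_eq` + ★ (e2)).
* §1 `locToAdelic_cornerLoc` (the compatibility the K1 desk asked for, in the tree's own letters), `cornerLoc_mul` (`B_v` is multiplicative), `evalPlace_finPart_blkD_inr_eq_cornerLoc`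
  (`(blkD (1,y))_v = B_v(y_v)`: the `v`-component of the chart depends on `y_v` only), `evalPlace_finPart_blkD_inr_mul` (`(blkD(1,y)·g)_v = B_v(y_v)·g_v`).
* §2 `cornerLoc_mem_siegelDeltaLoc` (`u ∈ P⁽ᴮ⁾_Δ(L⁺_v) ⇒ B_v u ∈ P_Δ(L⁺_v)`, ★ `isSiegelDelta_blkD`), **`siegelCharLoc_cornerLoc`** (`σ^{(V)}_{χ,s,v}(B_v p) = σ^{(V₂)}_{χ,s+n₁∕2,v}(p)`, ★ p862495
  `siegelDeltaCharacter_blkD_inr` — THE LOCAL MODULUS SHIFT), `cornerLoc_mem_localInt_iff` (★ (e2′)).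
* §3 **`lambdaLoc_cornerLoc_mul`** — for `χ` unramified above `v`, a decomposition `u = p · k₁` (`p ∈ P⁽ᴮ⁾_Δ(L⁺_v)`, `k₁ ∈ K⁽ᴮ⁾_v`, ★ `IsSiegelIntDecomp`, by value) and `k ∈ K_v`:
  `Λ^{(V)}_{s,v}(B_v(u) · k) = Λ^{(V₂)}_{s+n₁∕2,v}(u)` (★ `lambdaLoc_mul_eq` on both sides + §2) — the SPHERICAL COMPONENT of the translated corner family off `T(g)`, i.e. the per-place
  identity the (e3) factorizability transport multiplies over `v ∉ T(g) ∪ {v : y_v ∉ K⁽ᴮ⁾_v}` (decompositions exist off the datum's bad places: ★ `K2LiuSphericalSectionLambdaLoc.exists_isSiegelIntDecomp`).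
[Kudla1994, §2–§3], [KudlaRallis1994, §2], [Li1992, §3], [GelbartPiatetskishapiroRallis1987, Part A §1, §6], [BorelJacquet1979, §4.1].
HONEST LABEL.  Count-neutral helper, closes no socket: `HC_CM` is proved only modulo the 7 printed citations (2 remaining named inputs: hLiu418 =
`stmt-HodgeConjecture-24832`, h413 = `stmt-HodgeConjecture-24833`) until rung 0 closes.

## References
* [Kudla1994] S. S. Kudla, *Splitting metaplectic covers of dual reductive pairs*, Israel J. Math. 87 (1994), §2–§3.
* [KudlaRallis1994] S. S. Kudla, S. Rallis, *A regularized Siegel–Weil formula: the first term identity*, Ann. of Math. 140 (1994), §2.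
* [Li1992] J.-S. Li, *Non-vanishing theorems for the cohomology of certain arithmetic quotients*, J. reine angew. Math. 428 (1992), §3.
* [GelbartPiatetskishapiroRallis1987] S. Gelbart, I. Piatetski-Shapiro, S. Rallis, LNM 1254 (1987), Part A §1, §6.
* [BorelJacquet1979] A. Borel, H. Jacquet, Proc. Symp. Pure Math. 33.1 (1979), §4.1.
-/

set_option autoImplicit false
set_option linter.dupNamespace false -- the mandated namespace repeats `HodgeConjecture.HodgeConjecture`

noncomputable section

open scoped Classical
open scoped Matrix
open NumberField IsDedekindDomain
open Literature.NumberTheory.Automorphic Literature.NumberTheory.GaloisRepresentations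
open Literature.NumberTheory.GelbartRogawski1991 Literature.NumberTheory.GelbartRogawski1991.GRConstruction
open Literature.NumberTheory.GelbartRogawski1991.UnitaryDualPair
open Literature.NumberTheory.K2Lit.SiegelDoubled
open Summit.HodgeConjecture.HodgeConjecture.Cruxes.HLiu418.K2LiuBlockDiagPlaces
open Summit.HodgeConjecture.HodgeConjecture.Cruxes.HLiu418.K2LiuBlockDiagIntegral
open Summit.HodgeConjecture.HodgeConjecture.Cruxes.HLiu418.K2LiuBlockDiagSectionPullback (siegelDeltaCharacter_blkD_inr)
open Summit.HodgeConjecture.HodgeConjecture.Cruxes.HLiu418.K2LiuDoublingHeckeIteration (eq_of_archPart_eq_of_forall_evalPlace_eq)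

namespace Summit.HodgeConjecture.HodgeConjecture.Cruxes.HLiu418.K2LiuKindOneLineLocalPullback

variable (L : Type) [Field L] [NumberField L] [IsCMField L]
variable {N₁ N₂ M n n₁ n₂ : ℕ} (eV : Fin (N₁ + N₂) × Fin M ≃ Fin n) (eA : Fin N₁ × Fin M ≃ Fin n₁) (eB : Fin N₂ × Fin M ≃ Fin n₂)
  (dA : Fin N₁ → L) (hdA : ∀ i, IsCMField.complexConj L (dA i) = dA i)
  (dB : Fin N₂ → L) (hdB : ∀ i, IsCMField.complexConj L (dB i) = dB i)
  (dV : Fin (N₁ + N₂) → L) (hdV : ∀ i, IsCMField.complexConj L (dV i) = dV i)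
  (hVA : ∀ i, dV (Fin.castAdd N₂ i) = dA i) (hVB : ∀ j, dV (Fin.natAdd N₁ j) = dB j)
  (dW : Fin M → L) (hdW : ∀ i, IsCMField.complexConj L (dW i) = dW i)
  (v : HeightOneSpectrum (𝓞 (Fp L)))

/-! ## §1 The local corner chart `B_v(u) = (blkD (1, ι_v u))_v` and the compatibility `ι_v (B_v u) = blkD (1, ι_v u)` -/

set_option maxHeartbeats 1600000 in -- MEASURED: the defeq `locToAdelic = UnitaryGroup.inclPlaceAdelic` (★ def, codomain spelled `↥HA` vs `.Adelic`) is unfolded by `exact`∕`rw` at the two datum sizes; 200000 times out at `whnf`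
/-- **`ι_v (B_v u) = blkD (1, ι_v u)`** — Kudla's see-saw chart maps the place-`v` copy of `U(J^𝔻_{V₂})(L⁺_v)` into the place-`v` copy of `U(J^𝔻_V)(L⁺_v)`: `blkD (1, ι_v u)` has
archimedean part `1` and component `1` at every finite place `w ≠ v` (★ (e2) `coe_archPart_blkD_inr` ∕ `coe_evalPlace_finPart_blkD_inr`, ★ `archPart_inclPlaceAdelic`,
★ `evalPlace_finPart_inclPlaceAdelic`), so it is the `ι_v`-image of its own `v`-component (★ `eq_of_archPart_eq_of_forall_evalPlace_eq`). [cite: Kudla1994, §2–§3] [cite: BorelJacquet1979, §4.1] -/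
theorem locToAdelic_cornerLoc (u : UnitaryGroup.localPi L (IsCMField.complexConj L) (n₂ + n₂) (hermD L eB dB hdB dW hdW) v) :
    locToAdelic L eV dV hdV dW hdW v (UnitaryGroup.evalPlace (Fp L) L (IsCMField.complexConj L) (n + n) (hermD L eV dV hdV dW hdW) v (UnitaryGroup.finPart (Fp L) L (IsCMField.complexConj L) (n + n) (hermD L eV dV hdV dW hdW) (blkD L eV eA eB dA hdA dB hdB dV hdV hVA hVB dW hdW (1, (locToAdelic L eB dB hdB dW hdW v u))))) =
      blkD L eV eA eB dA hdA dB hdB dV hdV hVA hVB dW hdW (1, (locToAdelic L eB dB hdB dW hdW v u)) := by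
  refine eq_of_archPart_eq_of_forall_evalPlace_eq (Fp L) L (IsCMField.complexConj L) (n + n) (hermD L eV dV hdV dW hdW) ?_ fun w => ?_
  · -- archimedean parts: both are `1`
    have h1 : UnitaryGroup.archPart (Fp L) L (IsCMField.complexConj L) (n + n) (hermD L eV dV hdV dW hdW) (locToAdelic L eV dV hdV dW hdW v (UnitaryGroup.evalPlace (Fp L) L (IsCMField.complexConj L) (n + n) (hermD L eV dV hdV dW hdW) v (UnitaryGroup.finPart (Fp L) L (IsCMField.complexConj L) (n + n) (hermD L eV dV hdV dW hdW) (blkD L eV eA eB dA hdA dB hdB dV hdV hVA hVB dW hdW (1, (locToAdelic L eB dB hdB dW hdW v u)))))) = 1 :=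
      UnitaryGroup.archPart_inclPlaceAdelic (Fp L) L (IsCMField.complexConj L) (n + n) (hermD L eV dV hdV dW hdW) v _
    have h2 : UnitaryGroup.archPart (Fp L) L (IsCMField.complexConj L) (n₂ + n₂) (hermD L eB dB hdB dW hdW) (locToAdelic L eB dB hdB dW hdW v u) = 1 :=
      UnitaryGroup.archPart_inclPlaceAdelic (Fp L) L (IsCMField.complexConj L) (n₂ + n₂) (hermD L eB dB hdB dW hdW) v u
    rw [h1]
    refine Subtype.ext ?_
    rw [coe_archPart_blkD_inr, h2, OneMemClass.coe_one, OneMemClass.coe_one, ← Prod.one_eq_mk, map_one, map_one]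
  · by_cases hw : w = v
    · subst hw
      exact UnitaryGroup.evalPlace_finPart_inclPlaceAdelic (Fp L) L (IsCMField.complexConj L) (n + n) (hermD L eV dV hdV dW hdW) w _
    · have h3 : UnitaryGroup.evalPlace (Fp L) L (IsCMField.complexConj L) (n + n) (hermD L eV dV hdV dW hdW) w (UnitaryGroup.finPart (Fp L) L (IsCMField.complexConj L) (n + n) (hermD L eV dV hdV dW hdW) (locToAdelic L eV dV hdV dW hdW v (UnitaryGroup.evalPlace (Fp L) L (IsCMField.complexConj L) (n + n) (hermD L eV dV hdV dW hdW) v (UnitaryGroup.finPart (Fp L) L (IsCMField.complexConj L) (n + n) (hermD L eV dV hdV dW hdW) (blkD L eV eA eB dA hdA dB hdB dV hdV hVA hVB dW hdW (1, (locToAdelic L eB dB hdB dW hdW v u))))))) = 1 := by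
        have h := Summit.HodgeConjecture.HodgeConjecture.Cruxes.HLiu418.K2LiuDoublingHeckeIteration.evalPlace_finPart_inclPlaceAdelic (Fp L) L (IsCMField.complexConj L) (n + n) (hermD L eV dV hdV dW hdW) v w (UnitaryGroup.evalPlace (Fp L) L (IsCMField.complexConj L) (n + n) (hermD L eV dV hdV dW hdW) v (UnitaryGroup.finPart (Fp L) L (IsCMField.complexConj L) (n + n) (hermD L eV dV hdV dW hdW) (blkD L eV eA eB dA hdA dB hdB dV hdV hVA hVB dW hdW (1, (locToAdelic L eB dB hdB dW hdW v u)))))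
        rw [dif_neg hw] at h
        exact h
      have h4 : UnitaryGroup.evalPlace (Fp L) L (IsCMField.complexConj L) (n₂ + n₂) (hermD L eB dB hdB dW hdW) w (UnitaryGroup.finPart (Fp L) L (IsCMField.complexConj L) (n₂ + n₂) (hermD L eB dB hdB dW hdW) (locToAdelic L eB dB hdB dW hdW v u)) = 1 := by
        have h := Summit.HodgeConjecture.HodgeConjecture.Cruxes.HLiu418.K2LiuDoublingHeckeIteration.evalPlace_finPart_inclPlaceAdelic (Fp L) L (IsCMField.complexConj L) (n₂ + n₂) (hermD L eB dB hdB dW hdW) v w u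
        rw [dif_neg hw] at h
        exact h
      rw [h3]
      refine Subtype.ext (funext fun w' => ?_)
      rw [coe_evalPlace_finPart_blkD_inr, h4, OneMemClass.coe_one, OneMemClass.coe_one, Pi.one_apply, Pi.one_apply, ← Prod.one_eq_mk, map_one,
        map_one]

/-- **`B_v` is multiplicative**: `B_v(u · u′) = B_v(u) · B_v(u′)` (composition of homomorphisms). [cite: Kudla1994, §2] -/
theorem cornerLoc_mul (u u' : UnitaryGroup.localPi L (IsCMField.complexConj L) (n₂ + n₂) (hermD L eB dB hdB dW hdW) v) :
    UnitaryGroup.evalPlace (Fp L) L (IsCMField.complexConj L) (n + n) (hermD L eV dV hdV dW hdW) v (UnitaryGroup.finPart (Fp L) L (IsCMField.complexConj L) (n + n) (hermD L eV dV hdV dW hdW) (blkD L eV eA eB dA hdA dB hdB dV hdV hVA hVB dW hdW (1, locToAdelic L eB dB hdB dW hdW v (u * u')))) =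
      UnitaryGroup.evalPlace (Fp L) L (IsCMField.complexConj L) (n + n) (hermD L eV dV hdV dW hdW) v (UnitaryGroup.finPart (Fp L) L (IsCMField.complexConj L) (n + n) (hermD L eV dV hdV dW hdW) (blkD L eV eA eB dA hdA dB hdB dV hdV hVA hVB dW hdW (1, locToAdelic L eB dB hdB dW hdW v u))) *
        UnitaryGroup.evalPlace (Fp L) L (IsCMField.complexConj L) (n + n) (hermD L eV dV hdV dW hdW) v (UnitaryGroup.finPart (Fp L) L (IsCMField.complexConj L) (n + n) (hermD L eV dV hdV dW hdW) (blkD L eV eA eB dA hdA dB hdB dV hdV hVA hVB dW hdW (1, locToAdelic L eB dB hdB dW hdW v u'))) := by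
  have hblk : blkD L eV eA eB dA hdA dB hdB dV hdV hVA hVB dW hdW (1, locToAdelic L eB dB hdB dW hdW v (u * u')) =
      blkD L eV eA eB dA hdA dB hdB dV hdV hVA hVB dW hdW (1, locToAdelic L eB dB hdB dW hdW v u) * blkD L eV eA eB dA hdA dB hdB dV hdV hVA hVB dW hdW (1, locToAdelic L eB dB hdB dW hdW v u') := by
    rw [map_mul, ← map_mul (blkD L eV eA eB dA hdA dB hdB dV hdV hVA hVB dW hdW), Prod.mk_mul_mk, mul_one]
  have hfin : UnitaryGroup.finPart (Fp L) L (IsCMField.complexConj L) (n + n) (hermD L eV dV hdV dW hdW)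
      (blkD L eV eA eB dA hdA dB hdB dV hdV hVA hVB dW hdW (1, locToAdelic L eB dB hdB dW hdW v u) * blkD L eV eA eB dA hdA dB hdB dV hdV hVA hVB dW hdW (1, locToAdelic L eB dB hdB dW hdW v u')) =
      UnitaryGroup.finPart (Fp L) L (IsCMField.complexConj L) (n + n) (hermD L eV dV hdV dW hdW) (blkD L eV eA eB dA hdA dB hdB dV hdV hVA hVB dW hdW (1, locToAdelic L eB dB hdB dW hdW v u)) *
        UnitaryGroup.finPart (Fp L) L (IsCMField.complexConj L) (n + n) (hermD L eV dV hdV dW hdW) (blkD L eV eA eB dA hdA dB hdB dV hdV hVA hVB dW hdW (1, locToAdelic L eB dB hdB dW hdW v u')) := map_mul _ _ _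
  rw [hblk, hfin, map_mul]

/-- **`(blkD (1, y))_v = B_v(y_v)`**: the `v`-component of the chart depends on `y_v` only (★ (e2) twice: both sides are `σ⁻¹[diag(1, (y_v)_w)]_w`, ★ `evalPlace_finPart_inclPlaceAdelic`).
[cite: Kudla1994, §2] [cite: BorelJacquet1979, §4.1] -/
theorem evalPlace_finPart_blkD_inr_eq_cornerLoc (y : HA L eB dB hdB dW hdW) :
    UnitaryGroup.evalPlace (Fp L) L (IsCMField.complexConj L) (n + n) (hermD L eV dV hdV dW hdW) v (UnitaryGroup.finPart (Fp L) L (IsCMField.complexConj L) (n + n) (hermD L eV dV hdV dW hdW) (blkD L eV eA eB dA hdA dB hdB dV hdV hVA hVB dW hdW (1, y))) =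
      UnitaryGroup.evalPlace (Fp L) L (IsCMField.complexConj L) (n + n) (hermD L eV dV hdV dW hdW) v (UnitaryGroup.finPart (Fp L) L (IsCMField.complexConj L) (n + n) (hermD L eV dV hdV dW hdW) (blkD L eV eA eB dA hdA dB hdB dV hdV hVA hVB dW hdW (1, locToAdelic L eB dB hdB dW hdW v (UnitaryGroup.evalPlace (Fp L) L (IsCMField.complexConj L) (n₂ + n₂) (hermD L eB dB hdB dW hdW) v (UnitaryGroup.finPart (Fp L) L (IsCMField.complexConj L) (n₂ + n₂) (hermD L eB dB hdB dW hdW) y))))) := by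
  have hself : UnitaryGroup.evalPlace (Fp L) L (IsCMField.complexConj L) (n₂ + n₂) (hermD L eB dB hdB dW hdW) v (UnitaryGroup.finPart (Fp L) L (IsCMField.complexConj L) (n₂ + n₂) (hermD L eB dB hdB dW hdW) (locToAdelic L eB dB hdB dW hdW v (UnitaryGroup.evalPlace (Fp L) L (IsCMField.complexConj L) (n₂ + n₂) (hermD L eB dB hdB dW hdW) v (UnitaryGroup.finPart (Fp L) L (IsCMField.complexConj L) (n₂ + n₂) (hermD L eB dB hdB dW hdW) y)))) = (UnitaryGroup.evalPlace (Fp L) L (IsCMField.complexConj L) (n₂ + n₂) (hermD L eB dB hdB dW hdW) v (UnitaryGroup.finPart (Fp L) L (IsCMField.complexConj L) (n₂ + n₂) (hermD L eB dB hdB dW hdW) y)) :=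
    UnitaryGroup.evalPlace_finPart_inclPlaceAdelic (Fp L) L (IsCMField.complexConj L) (n₂ + n₂) (hermD L eB dB hdB dW hdW) v _
  refine Subtype.ext (funext fun w' => ?_)
  rw [coe_evalPlace_finPart_blkD_inr, coe_evalPlace_finPart_blkD_inr, hself]

/-- **`(blkD (1, y) · g)_v = B_v(y_v) · g_v`** — the `v`-component of the translated corner family's argument. [cite: Kudla1994, §2] [cite: BorelJacquet1979, §4.1] -/
theorem evalPlace_finPart_blkD_inr_mul (y : HA L eB dB hdB dW hdW) (g : HA L eV dV hdV dW hdW) :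
    UnitaryGroup.evalPlace (Fp L) L (IsCMField.complexConj L) (n + n) (hermD L eV dV hdV dW hdW) v (UnitaryGroup.finPart (Fp L) L (IsCMField.complexConj L) (n + n) (hermD L eV dV hdV dW hdW) (blkD L eV eA eB dA hdA dB hdB dV hdV hVA hVB dW hdW (1, y) * g)) =
      UnitaryGroup.evalPlace (Fp L) L (IsCMField.complexConj L) (n + n) (hermD L eV dV hdV dW hdW) v (UnitaryGroup.finPart (Fp L) L (IsCMField.complexConj L) (n + n) (hermD L eV dV hdV dW hdW) (blkD L eV eA eB dA hdA dB hdB dV hdV hVA hVB dW hdW (1, locToAdelic L eB dB hdB dW hdW v (UnitaryGroup.evalPlace (Fp L) L (IsCMField.complexConj L) (n₂ + n₂) (hermD L eB dB hdB dW hdW) v (UnitaryGroup.finPart (Fp L) L (IsCMField.complexConj L) (n₂ + n₂) (hermD L eB dB hdB dW hdW) y))))) *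
        UnitaryGroup.evalPlace (Fp L) L (IsCMField.complexConj L) (n + n) (hermD L eV dV hdV dW hdW) v (UnitaryGroup.finPart (Fp L) L (IsCMField.complexConj L) (n + n) (hermD L eV dV hdV dW hdW) g) := by
  have hmul : UnitaryGroup.finPart (Fp L) L (IsCMField.complexConj L) (n + n) (hermD L eV dV hdV dW hdW) (blkD L eV eA eB dA hdA dB hdB dV hdV hVA hVB dW hdW (1, y) * g) =
      UnitaryGroup.finPart (Fp L) L (IsCMField.complexConj L) (n + n) (hermD L eV dV hdV dW hdW) (blkD L eV eA eB dA hdA dB hdB dV hdV hVA hVB dW hdW (1, y)) * UnitaryGroup.finPart (Fp L) L (IsCMField.complexConj L) (n + n) (hermD L eV dV hdV dW hdW) g := map_mul _ _ _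
  rw [hmul, map_mul, evalPlace_finPart_blkD_inr_eq_cornerLoc]

/-! ## §2 The local Siegel bookkeeping of `B_v` through `ι_v` -/

/-- **`u ∈ P_Δ^{(V₂)}(L⁺_v) ⇒ B_v u ∈ P_Δ^{(V)}(L⁺_v)`** (★ `siegelDeltaLoc = siegelDelta.comap ι_v`, §1, ★ `isSiegelDelta_blkD`). [cite: Kudla1994, §2–§3] -/
theorem cornerLoc_mem_siegelDeltaLoc {u : UnitaryGroup.localPi L (IsCMField.complexConj L) (n₂ + n₂) (hermD L eB dB hdB dW hdW) v} (hu : u ∈ siegelDeltaLoc L eB dB hdB dW hdW v) :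
    UnitaryGroup.evalPlace (Fp L) L (IsCMField.complexConj L) (n + n) (hermD L eV dV hdV dW hdW) v (UnitaryGroup.finPart (Fp L) L (IsCMField.complexConj L) (n + n) (hermD L eV dV hdV dW hdW) (blkD L eV eA eB dA hdA dB hdB dV hdV hVA hVB dW hdW (1, (locToAdelic L eB dB hdB dW hdW v u)))) ∈ siegelDeltaLoc L eV dV hdV dW hdW v := by
  rw [mem_siegelDeltaLoc_iff, locToAdelic_cornerLoc]
  exact isSiegelDelta_blkD L eV eA eB dA hdA dB hdB dV hdV hVA hVB dW hdW (isSiegelDelta_one' L eA dA hdA dW hdW) ((mem_siegelDeltaLoc_iff L eB dB hdB dW hdW v u).1 hu)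

/-- **THE LOCAL MODULUS SHIFT: `σ^{(V)}_{χ,s,v}(B_v p) = σ^{(V₂)}_{χ, s + n₁∕2, v}(p)`** for `p ∈ P_Δ^{(V₂)}(L⁺_v)` (★ `siegelCharLoc v χ s u = siegelDeltaCharacter χ s (ι_v u)`, §1, ★ p862495
`siegelDeltaCharacter_blkD_inr`). [cite: Kudla1994, §2, Thm. 3.1] [cite: KudlaRallis1994, §2] -/
theorem siegelCharLoc_cornerLoc (χ : HeckeCharacter L) (s : ℂ) {p : UnitaryGroup.localPi L (IsCMField.complexConj L) (n₂ + n₂) (hermD L eB dB hdB dW hdW) v} (hp : p ∈ siegelDeltaLoc L eB dB hdB dW hdW v) :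
    siegelCharLoc L eV dV hdV dW hdW v χ s (UnitaryGroup.evalPlace (Fp L) L (IsCMField.complexConj L) (n + n) (hermD L eV dV hdV dW hdW) v (UnitaryGroup.finPart (Fp L) L (IsCMField.complexConj L) (n + n) (hermD L eV dV hdV dW hdW) (blkD L eV eA eB dA hdA dB hdB dV hdV hVA hVB dW hdW (1, locToAdelic L eB dB hdB dW hdW v p)))) =
      siegelCharLoc L eB dB hdB dW hdW v χ (s + (n₁ : ℂ) / 2) p := by
  rw [siegelCharLoc_apply, siegelCharLoc_apply, locToAdelic_cornerLoc]
  exact siegelDeltaCharacter_blkD_inr L eV eA eB dA hdA dB hdB dV hdV hVA hVB dW hdW χ s ((mem_siegelDeltaLoc_iff L eB dB hdB dW hdW v p).1 hp)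

/-- **`B_v u ∈ K_v ↔ u ∈ K^{(V₂)}_v`** (★ (e2′) `blkD_inr_mem_localInt_iff` at `y := ι_v u`, ★ `evalPlace_finPart_inclPlaceAdelic`). [cite: Kudla1994, §3] -/
theorem cornerLoc_mem_localInt_iff (u : UnitaryGroup.localPi L (IsCMField.complexConj L) (n₂ + n₂) (hermD L eB dB hdB dW hdW) v) :
    UnitaryGroup.evalPlace (Fp L) L (IsCMField.complexConj L) (n + n) (hermD L eV dV hdV dW hdW) v (UnitaryGroup.finPart (Fp L) L (IsCMField.complexConj L) (n + n) (hermD L eV dV hdV dW hdW) (blkD L eV eA eB dA hdA dB hdB dV hdV hVA hVB dW hdW (1, (locToAdelic L eB dB hdB dW hdW v u)))) ∈ UnitaryGroup.localInt L (IsCMField.complexConj L) (n + n) (hermD L eV dV hdV dW hdW) v ↔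
      u ∈ UnitaryGroup.localInt L (IsCMField.complexConj L) (n₂ + n₂) (hermD L eB dB hdB dW hdW) v := by
  have hself : UnitaryGroup.evalPlace (Fp L) L (IsCMField.complexConj L) (n₂ + n₂) (hermD L eB dB hdB dW hdW) v (UnitaryGroup.finPart (Fp L) L (IsCMField.complexConj L) (n₂ + n₂) (hermD L eB dB hdB dW hdW) (locToAdelic L eB dB hdB dW hdW v u)) = u :=
    UnitaryGroup.evalPlace_finPart_inclPlaceAdelic (Fp L) L (IsCMField.complexConj L) (n₂ + n₂) (hermD L eB dB hdB dW hdW) v u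
  rw [blkD_inr_mem_localInt_iff, hself]

/-! ## §3 The local spherical pull-back -/

/-- **THE LOCAL SPHERICAL PULL-BACK: `Λ^{(V)}_{s,v}(B_v(u) · k) = Λ^{(V₂)}_{s + n₁∕2, v}(u)`** for `χ` unramified above `v`, `u = p · k₁` a Siegel–integral decomposition in `U(J^𝔻_{V₂})(L⁺_v)`
(★ `IsSiegelIntDecomp`, by value — it exists off the datum's bad places, ★ `exists_isSiegelIntDecomp`) and `k ∈ K_v`: `B_v(u)·k = B_v(p) · (B_v(k₁)·k)` with `B_v(p) ∈ P_Δ(L⁺_v)`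
(§2) and `B_v(k₁)·k ∈ K_v` (§2), so ★ `lambdaLoc_mul_eq` on both sides and the modulus shift §2 give the identity — the spherical component `Λ⁽¹⁾_{s+½,v}` of the translated
corner family off `T(g)` (line lead's WORD #1 (1)). [cite: Li1992, §3] [cite: GelbartPiatetskishapiroRallis1987, Part A §6] [cite: KudlaRallis1994, §2] -/
theorem lambdaLoc_cornerLoc_mul (χ : HeckeCharacter L) (s : ℂ) (hχ : ∀ w : UnitaryGroup.PlacesOver L v, χ.IsUnramifiedAt w.1)
    {u p k₁ : UnitaryGroup.localPi L (IsCMField.complexConj L) (n₂ + n₂) (hermD L eB dB hdB dW hdW) v} (hdec : IsSiegelIntDecomp L eB dB hdB dW hdW v u (p, k₁))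
    {k : UnitaryGroup.localPi L (IsCMField.complexConj L) (n + n) (hermD L eV dV hdV dW hdW) v} (hk : k ∈ UnitaryGroup.localInt L (IsCMField.complexConj L) (n + n) (hermD L eV dV hdV dW hdW) v) :
    LambdaLoc L eV dV hdV dW hdW v χ s (UnitaryGroup.evalPlace (Fp L) L (IsCMField.complexConj L) (n + n) (hermD L eV dV hdV dW hdW) v (UnitaryGroup.finPart (Fp L) L (IsCMField.complexConj L) (n + n) (hermD L eV dV hdV dW hdW) (blkD L eV eA eB dA hdA dB hdB dV hdV hVA hVB dW hdW (1, (locToAdelic L eB dB hdB dW hdW v u)))) * k) =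
      LambdaLoc L eB dB hdB dW hdW v χ (s + (n₁ : ℂ) / 2) u := by
  obtain ⟨hp, hk₁, rfl⟩ := hdec
  dsimp only at hp hk₁ ⊢
  rw [cornerLoc_mul, mul_assoc,
    lambdaLoc_mul_eq L eV dV hdV dW hdW v χ s hχ (cornerLoc_mem_siegelDeltaLoc L eV eA eB dA hdA dB hdB dV hdV hVA hVB dW hdW v hp)
      (mul_mem ((cornerLoc_mem_localInt_iff L eV eA eB dA hdA dB hdB dV hdV hVA hVB dW hdW v k₁).2 hk₁) hk),
    lambdaLoc_mul_eq L eB dB hdB dW hdW v χ (s + (n₁ : ℂ) / 2) hχ hp hk₁,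
    siegelCharLoc_cornerLoc L eV eA eB dA hdA dB hdB dV hdV hVA hVB dW hdW v χ s hp]

/-- the same with `k = 1`: `Λ^{(V)}_{s,v}(B_v u) = Λ^{(V₂)}_{s+n₁∕2,v}(u)`. [cite: Li1992, §3] [cite: KudlaRallis1994, §2] -/
theorem lambdaLoc_cornerLoc (χ : HeckeCharacter L) (s : ℂ) (hχ : ∀ w : UnitaryGroup.PlacesOver L v, χ.IsUnramifiedAt w.1)
    {u p k₁ : UnitaryGroup.localPi L (IsCMField.complexConj L) (n₂ + n₂) (hermD L eB dB hdB dW hdW) v} (hdec : IsSiegelIntDecomp L eB dB hdB dW hdW v u (p, k₁)) :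
    LambdaLoc L eV dV hdV dW hdW v χ s (UnitaryGroup.evalPlace (Fp L) L (IsCMField.complexConj L) (n + n) (hermD L eV dV hdV dW hdW) v (UnitaryGroup.finPart (Fp L) L (IsCMField.complexConj L) (n + n) (hermD L eV dV hdV dW hdW) (blkD L eV eA eB dA hdA dB hdB dV hdV hVA hVB dW hdW (1, (locToAdelic L eB dB hdB dW hdW v u))))) =
      LambdaLoc L eB dB hdB dW hdW v χ (s + (n₁ : ℂ) / 2) u := by
  rw [← mul_one (UnitaryGroup.evalPlace (Fp L) L (IsCMField.complexConj L) (n + n) (hermD L eV dV hdV dW hdW) v (UnitaryGroup.finPart (Fp L) L (IsCMField.complexConj L) (n + n) (hermD L eV dV hdV dW hdW) (blkD L eV eA eB dA hdA dB hdB dV hdV hVA hVB dW hdW (1, (locToAdelic L eB dB hdB dW hdW v u)))))]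
  exact lambdaLoc_cornerLoc_mul L eV eA eB dA hdA dB hdB dV hdV hVA hVB dW hdW v χ s hχ hdec (one_mem _)

/-- **the spherical component of the translated corner family's argument**: for `g_v ∈ K_v`, `χ` unramified above `v` and `y_v = p·k₁` decomposable,
`Λ^{(V)}_{s,v}((blkD (1,y) · g)_v) = Λ^{(V₂)}_{s+n₁∕2,v}(y_v)` (§1 `evalPlace_finPart_blkD_inr_mul` + §3). [cite: Li1992, §3] [cite: KudlaRallis1994, §2] [cite: BorelJacquet1979, §4.1] -/
theorem lambdaLoc_evalPlace_blkD_inr_mul (χ : HeckeCharacter L) (s : ℂ) (hχ : ∀ w : UnitaryGroup.PlacesOver L v, χ.IsUnramifiedAt w.1)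
    (y : HA L eB dB hdB dW hdW) {p k₁ : UnitaryGroup.localPi L (IsCMField.complexConj L) (n₂ + n₂) (hermD L eB dB hdB dW hdW) v}
    (hdec : IsSiegelIntDecomp L eB dB hdB dW hdW v (UnitaryGroup.evalPlace (Fp L) L (IsCMField.complexConj L) (n₂ + n₂) (hermD L eB dB hdB dW hdW) v (UnitaryGroup.finPart (Fp L) L (IsCMField.complexConj L) (n₂ + n₂) (hermD L eB dB hdB dW hdW) y)) (p, k₁))
    {g : HA L eV dV hdV dW hdW} (hg : UnitaryGroup.evalPlace (Fp L) L (IsCMField.complexConj L) (n + n) (hermD L eV dV hdV dW hdW) v (UnitaryGroup.finPart (Fp L) L (IsCMField.complexConj L) (n + n) (hermD L eV dV hdV dW hdW) g) ∈ UnitaryGroup.localInt L (IsCMField.complexConj L) (n + n) (hermD L eV dV hdV dW hdW) v) :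
    LambdaLoc L eV dV hdV dW hdW v χ s (UnitaryGroup.evalPlace (Fp L) L (IsCMField.complexConj L) (n + n) (hermD L eV dV hdV dW hdW) v (UnitaryGroup.finPart (Fp L) L (IsCMField.complexConj L) (n + n) (hermD L eV dV hdV dW hdW) (blkD L eV eA eB dA hdA dB hdB dV hdV hVA hVB dW hdW (1, y) * g))) =
      LambdaLoc L eB dB hdB dW hdW v χ (s + (n₁ : ℂ) / 2) (UnitaryGroup.evalPlace (Fp L) L (IsCMField.complexConj L) (n₂ + n₂) (hermD L eB dB hdB dW hdW) v (UnitaryGroup.finPart (Fp L) L (IsCMField.complexConj L) (n₂ + n₂) (hermD L eB dB hdB dW hdW) y)) := by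
  rw [evalPlace_finPart_blkD_inr_mul]
  exact lambdaLoc_cornerLoc_mul L eV eA eB dA hdA dB hdB dV hdV hVA hVB dW hdW v χ s hχ hdec hg

end Summit.HodgeConjecture.HodgeConjecture.Cruxes.HLiu418.K2LiuKindOneLineLocalPullback

end
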